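import Mathlib
import HarnessLib

/-!
# `NoHeavyLowerTail` (crux stmt-CriticalPhenomena-4575), antithetic vdBHK programme: the PAIR REDUCTION for two branching legs

Support file (seat `prim-ineq-gen-7` gen 37; `--supports stmt-CriticalPhenomena-4575`).  Nothing is asserted about the crux; no `sorry`.
Memo: run/shared/lean/prim/prim-ineq-gen-7/FINDING-TWOLEG-g37.md §2–§4 (THEOREM R, THEOREM PAIR-BROOM, TWO-BROOM THEOREM), continuing
PROOF-PG-g32 (THEOREM PG: `LP^G(P)`, the pure-localized leg `P` against the mixed leg `G`).

CONTEXT.  For a broom `P = F_v(broom_r)` (bottoms `(R,γ)`, tops `(B,γ)`, `γ ⊆ [r]`, every bottom below every top, `K((R,γ)) ∋ (B,γ̄)`,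
`K((B,γ)) = {(R,γ') : γ' ⊆ γ}`) the localized inequality `LP^G(P)`: `Σ_{x ∈ Z} q^G(x) ≥ 0` over a down-set `Z = Bot ∪ S` reads
`Σ_γ s_γ + Σ_{γ ∈ S} q^G((B,γ)) ≥ 0` with bottom terms `s_γ = prod(b_γ) + cert(t_γ̄, b_γ) ≥ 0` and top terms bounded below by
`u_γ = prod(t_γ) + cert(b_γ, t_γ)` (dropping the routes through the other bottoms, `cert` being monotone in the routes).  THEOREM R of the memo:
if every ANTIPODAL PAIR `{γ, γ̄}` satisfies `PAIR^G(z_γ, z_γ̄) = s_γ + s_γ̄ + z_γ u_γ + z_γ̄ u_γ̄ ≥ 0` (`z_γ = [(B,γ) ∈ S]`), then `LP^G(P)` holds.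
This file kernel-checks the combinatorial core of that reduction for an arbitrary finite index type with a fixed-point-free involution
(`pairReduction`), the monotone weakening step (`pairReduction_of_le`), and records the algebraic identity behind the PROPOSITION of §4:
patterns `(0,1)`, `(1,0)` of `PAIR` are a `BASE(zt=1)` term plus a `HUB(0,1)` term of CONJECTURE HB (`pair01_eq_base_add_hub01`), so that
CONJECTURE PAIR reduces to its `(1,1)` pattern.
-/

namespace Summit.CriticalPhenomena.PercolationContinuityZ3.Theorems

namespace AntitheticPairReduction

open Finset

variable {Γ : Type*} [Fintype Γ]

/-- Summing a function over a finite type is invariant under an involution of the index (re-indexing by the involution,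
which is a bijection). [this work] -/
theorem sum_comp_involution (bar : Γ → Γ) (hbar : Function.Involutive bar) (f : Γ → ℤ) :
    ∑ γ, f (bar γ) = ∑ γ, f γ :=
  Fintype.sum_equiv (hbar.toPerm bar) (fun γ => f (bar γ)) f (fun _ => rfl)

/-- PAIR REDUCTION (THEOREM R, combinatorial core).  Let `bar` be an involution of the finite index type `Γ` (the antipodal map
`γ ↦ γ̄` of the broom's leaf cube), `s u : Γ → ℤ` the bottom and (lower bounds of the) top terms, and `z : Γ → Bool` the indicator of the
tops lying in the down-set.  If every antipodal pair is nonnegative,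
`s γ + s (bar γ) + [z γ] u γ + [z (bar γ)] u (bar γ) ≥ 0`, then the whole localized sum `Σ_γ (s γ + [z γ] u γ)` is nonnegative —
each pair is counted twice when summing the pair inequalities over `γ`. [this work] -/
theorem pairReduction (bar : Γ → Γ) (hbar : Function.Involutive bar) (s u : Γ → ℤ) (z : Γ → Bool)
    (hpair : ∀ γ, 0 ≤ s γ + s (bar γ) + (if z γ then u γ else 0) + (if z (bar γ) then u (bar γ) else 0)) :
    0 ≤ ∑ γ, (s γ + (if z γ then u γ else 0)) := by
  set f : Γ → ℤ := fun γ => s γ + (if z γ then u γ else 0) with hf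
  have hre : ∑ γ, f (bar γ) = ∑ γ, f γ := sum_comp_involution bar hbar f
  have hsum : 0 ≤ ∑ γ, (f γ + f (bar γ)) := by
    apply Finset.sum_nonneg
    intro γ _
    have := hpair γ
    simp only [hf] at this ⊢
    linarith
  have hsplit : ∑ γ, (f γ + f (bar γ)) = ∑ γ, f γ + ∑ γ, f (bar γ) := Finset.sum_add_distrib
  rw [hsplit, hre] at hsum
  linarith

/-- The weakening step of THEOREM R: if the actual top terms `q γ` dominate the pair-local lower bounds `u γ` (certificates are monotone
in the routes, and the broom top `(B,γ)` is routed through `(R,γ)` among others), the bottom terms are exact, and the antipodal pairs of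
lower bounds are nonnegative, then the localized sum with the ACTUAL top terms is nonnegative. [this work] -/
theorem pairReduction_of_le (bar : Γ → Γ) (hbar : Function.Involutive bar) (s u q : Γ → ℤ) (z : Γ → Bool)
    (hqu : ∀ γ, u γ ≤ q γ)
    (hpair : ∀ γ, 0 ≤ s γ + s (bar γ) + (if z γ then u γ else 0) + (if z (bar γ) then u (bar γ) else 0)) :
    0 ≤ ∑ γ, (s γ + (if z γ then q γ else 0)) := by
  have h0 := pairReduction bar hbar s u z hpair
  have hle : ∑ γ, (s γ + (if z γ then u γ else 0)) ≤ ∑ γ, (s γ + (if z γ then q γ else 0)) := by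
    apply Finset.sum_le_sum
    intro γ _
    by_cases hz : z γ
    · simp [hz, hqu γ]
    · simp [hz]
  linarith

omit [Fintype Γ] in
/-- The bottoms-only case of THEOREM R (`Z ⊆ Bot`): a sub-sum of nonnegative bottom terms is nonnegative. [this work] -/
theorem bottoms_only (s : Γ → ℤ) (B : Finset Γ) (hs : ∀ γ, 0 ≤ s γ) : 0 ≤ ∑ γ ∈ B, s γ :=
  Finset.sum_nonneg fun γ _ => hs γ

/-- PROPOSITION (patterns of PAIR), algebraic core.  With the G-functional atoms as integers — products `pb₁ pb₂ pt₁ pt₂` of the four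
quadruples and certificates `c_XY = cert(X, Y)` — the pattern-(0,1) pair functional
`PAIR(0,1) = [pb₁ + c(t₂,b₁)] + [pb₂ + c(t₁,b₂)] + [pt₂ + c(b₂,t₂)]` equals `BASE(b₁,t₂; zt=1) + HUB(B=b₂, T=t₁, U=t₂, AL=b₁; zT=0, zU=1)`
where `BASE(b,t;1) = pb + c(t,b) + pt + c(b,t)` and `HUB(B,T,U,AL;0,1) = pB + c(T,B) + c(B,U) − c(AL,U)`: the two `c(b₁,t₂)` terms cancel.
Hence CONJECTURE PAIR in patterns `(0,1)`, `(1,0)`, `(0,0)` follows from CONJECTURE HB, and `PAIR(1,1) = PAIR(0,1) + [pt₁ + c(b₁,t₁)]`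
is the only new pattern. [this work] -/
theorem pair01_eq_base_add_hub01 (pb₁ pb₂ pt₁ pt₂ c_t2b1 c_t1b2 c_b2t2 c_b1t2 c_b1t1 : ℤ) :
    ((pb₁ + c_t2b1) + (pb₂ + c_t1b2) + (pt₂ + c_b2t2)
        = (pb₁ + c_t2b1 + pt₂ + c_b1t2) + (pb₂ + c_t1b2 + c_b2t2 - c_b1t2)) ∧
    ((pb₁ + c_t2b1) + (pb₂ + c_t1b2) + (pt₁ + c_b1t1) + (pt₂ + c_b2t2)
        = ((pb₁ + c_t2b1) + (pb₂ + c_t1b2) + (pt₂ + c_b2t2)) + (pt₁ + c_b1t1)) := by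
  constructor <;> ring

end AntitheticPairReduction

end Summit.CriticalPhenomena.PercolationContinuityZ3.Theorems
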